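import Summits.KontsevichZagierPeriods.KontsevichZagierPeriods.Theorems.SoloBlindLegendreFlux
import HarnessLib

/-!
# Legendre's relation inside the rules, IV: the deformation theorem and the product form

`sliceRep_equivalent`: for real algebraic `μ, ν ∈ (0,1)` the slices `L_μ = [(0,1)², F(·,·,μ)]`,
`L_ν` are KZ-equivalent (five moves on the band: rate = divergence, two vanishing fluxes, null
modifications).  Anchor `μ = ½` (`legendre_euler`): `[L_μ] = 2·a(1)` in `Q` (`mkQ_sliceRep`),
`L_μ ~ [[0,1], 2/(1+t²)]` (`kz_legendre`, `kz_legendre_graph`), `∫∫ F = π/2` (`sliceRep_value`).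
Product form (`μ + ν = 1`; `K_μ = [(0,1), f_μ]`, `E_μ = [(0,1), e_μ]`): `[E_μ][K_ν] + [K_μ][E_ν]
- [K_μ][K_ν] = 2·a(1)` in `Q` (`mkQ_legendre`), `E K' + K E' - K K' = π/2` (`legendre_relation`).
-/

noncomputable section

namespace Summit.KontsevichZagierPeriods.KontsevichZagierPeriods.Theorems

open Set MeasureTheory
open Literature.ModelTheory.ExponentialFields (IsSemialgebraic)
open Literature.NumberTheory.Transcendental
open Literature.NumberTheory.Transcendental.KZ

namespace SoloBlind

section Deformation
variable (c : ModBand)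

/-- **The `x`-flux move**: in the layout `(y, μ, x)`, `[B_x, ∂G/∂x] - [base, 0]` is one move of
rule (3) with primitive `G`, fibre `x ∈ [0,1]`, since `G(0,y,μ) = G(1,y,μ) = 0`. -/
theorem fluxXRep_reindex_sub_zeroRep :
    of ((fluxXRep c).reindex eX) - of (zeroRep c) ∈ relations := by
  obtain ⟨h0, h1, h2⟩ := eX_apply
  have hW := ((fluxXRep c).reindex eX).isSemialgebraic_domain
  refine nl_three _ (zeroRep c) isAlgebraic_zero isAlgebraic_one zero_le_one
    (fun p q t => legG t p q) (fun p q t => legGx t p q)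
    (isSemialgebraicFunOn_legG (isSemialgebraicFunOn_apply hW 2)
      (isSemialgebraicFunOn_apply hW 0) (isSemialgebraicFunOn_apply hW 1))
    (fun w => ?_) (fun w => ?_) (fun v hv => ?_) (fun v hv t ht => ?_) (fun v _ => ?_)
  · simp only [IntegralRep.reindex_integrand, fluxXRep, h0, h1, h2]
  · have i0 : Fin.init w 0 = w 0 := rfl
    have i1 : Fin.init w 1 = w 1 := rfl
    simp only [IntegralRep.reindex_domain, mem_setOf_eq, fluxXRep, bandX, zeroRep, base, h0, h1,
      h2, i0, i1]
    constructor
    · rintro ⟨⟨hx, hy⟩, hμ⟩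
      exact ⟨⟨hy, hμ⟩, hx⟩
    · rintro ⟨⟨hy, hμ⟩, hx⟩
      exact ⟨⟨hx, hy⟩, hμ⟩
  · exact continuousOn_legG (by nlinarith [hv.1.1, hv.1.2]) (c.mem_Ioo hv.2)
  · exact hasDerivAt_legG (by nlinarith [ht.1, ht.2]) (by nlinarith [hv.1.1, hv.1.2])
      ⟨(c.mem_Ioo hv.2).1.le, (c.mem_Ioo hv.2).2.le⟩
  · simp [zeroRep, legG_zero_left, legG_one_left]

/-- **The `y`-flux move**: in the layout `(x, μ, y)`, `[B_y, ∂H/∂y] - [base, 0]` is one move of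
rule (3) with primitive `H`, fibre `y ∈ [0,1]`. -/
theorem fluxYRep_reindex_sub_zeroRep :
    of ((fluxYRep c).reindex eY) - of (zeroRep c) ∈ relations := by
  obtain ⟨h0, h1, h2⟩ := eY_apply
  have hW := ((fluxYRep c).reindex eY).isSemialgebraic_domain
  refine nl_three _ (zeroRep c) isAlgebraic_zero isAlgebraic_one zero_le_one
    (fun p q t => legH p t q) (fun p q t => legHy p t q)
    (isSemialgebraicFunOn_legH (isSemialgebraicFunOn_apply hW 0)
      (isSemialgebraicFunOn_apply hW 2) (isSemialgebraicFunOn_apply hW 1))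
    (fun w => ?_) (fun w => ?_) (fun v hv => ?_) (fun v hv t ht => ?_) (fun v _ => ?_)
  · simp only [IntegralRep.reindex_integrand, fluxYRep, h0, h1, h2]
  · have i0 : Fin.init w 0 = w 0 := rfl
    have i1 : Fin.init w 1 = w 1 := rfl
    simp only [IntegralRep.reindex_domain, mem_setOf_eq, fluxYRep, bandY, zeroRep, base, h0, h1,
      h2, i0, i1]
    constructor
    · rintro ⟨⟨hx, hy⟩, hμ⟩
      exact ⟨⟨hx, hμ⟩, hy⟩
    · rintro ⟨⟨hx, hμ⟩, hy⟩
      exact ⟨⟨hx, hy⟩, hμ⟩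
  · exact continuousOn_legH (by nlinarith [hv.1.1, hv.1.2]) (c.mem_Ioo hv.2)
  · exact hasDerivAt_legH (by nlinarith [hv.1.1, hv.1.2]) (by nlinarith [ht.1, ht.2])
      ⟨(c.mem_Ioo hv.2).1.le, (c.mem_Ioo hv.2).2.le⟩
  · simp [zeroRep, legH_zero, legH_one]

/-- `[B_x, ∂G/∂x]` is a relation: permutation + flux move + `[base, 0] ~ 0`. -/
theorem fluxXRep_mem : of (fluxXRep c) ∈ relations := by
  convert relations.add_mem (relations.add_mem (of_sub_of_reindex_mem_relations (fluxXRep c) eX)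
    (fluxXRep_reindex_sub_zeroRep c)) (zeroRep_mem c) using 1
  abel

/-- `[B_y, ∂H/∂y]` is a relation. -/
theorem fluxYRep_mem : of (fluxYRep c) ∈ relations := by
  convert relations.add_mem (relations.add_mem (of_sub_of_reindex_mem_relations (fluxYRep c) eY)
    (fluxYRep_reindex_sub_zeroRep c)) (zeroRep_mem c) using 1
  abel

/-- `[B, ∂G/∂x]` is a relation (null modification of `[B_x, ∂G/∂x]`). -/
theorem fluxXRepB_mem : of (fluxXRepB c) ∈ relations := by
  convert relations.sub_mem (fluxXRep_mem c) (fluxXRep_sub_fluxXRepB c) using 1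
  abel

/-- `[B, ∂H/∂y]` is a relation. -/
theorem fluxYRepB_mem : of (fluxYRepB c) ∈ relations := by
  convert relations.sub_mem (fluxYRep_mem c) (fluxYRep_sub_fluxYRepB c) using 1
  abel

/-- **`[B, ∂F/∂μ]` is a relation** (moves 2–4). -/
theorem rateRep_mem : of (rateRep c) ∈ relations := by
  convert relations.add_mem (relations.add_mem (rateRep_sub_fluxes c) (fluxXRepB_mem c))
    (fluxYRepB_mem c) using 1
  abel

/-- `[(0,1)², F_{m₂} - F_{m₁}]` is a relation (move 1). -/
theorem diffRep_mem : of (diffRep c) ∈ relations := by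
  convert relations.sub_mem (rateRep_mem c) (rateRep_sub_diffRep c) using 1
  abel

/-- **Modulus deformation on a band**: `[L_{m₂}] - [L_{m₁}]` is a relation. -/
theorem sliceRep_hi_sub_lo_mem :
    of (sliceRep c.hi c.hi_alg (c.mem_Ioo (right_mem_Icc.mpr c.lo_le_hi))) -
      of (sliceRep c.lo c.lo_alg (c.mem_Ioo (left_mem_Icc.mpr c.lo_le_hi))) ∈ relations := by
  convert relations.add_mem (slice_sub_diffRep_sub_slice c) (diffRep_mem c) using 1
  abel

/-- **Theorem (modulus deformation).** For real algebraic `μ, ν ∈ (0,1)` the slices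
`L_μ = [(0,1)², F(·,·,μ)]` and `L_ν` are KZ-equivalent. -/
theorem sliceRep_equivalent {μ ν : ℝ} (hμa : IsAlgebraic ℚ μ) (hνa : IsAlgebraic ℚ ν)
    (hμ : μ ∈ Ioo (0:ℝ) 1) (hν : ν ∈ Ioo (0:ℝ) 1) :
    Equivalent (sliceRep μ hμa hμ) (sliceRep ν hνa hν) := by
  rcases le_total ν μ with h | h
  · exact sliceRep_hi_sub_lo_mem ⟨ν, μ, hνa, hμa, hν.1, h, hμ.2⟩
  · have := relations.neg_mem (sliceRep_hi_sub_lo_mem ⟨μ, ν, hμa, hνa, hμ.1, h, hν.2⟩)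
    rw [neg_sub] at this
    exact this

/-- The same in the ring `Q`: the class `[L_μ] ∈ Q` does not depend on the algebraic modulus. -/
theorem mkQ_sliceRep_eq {μ ν : ℝ} (hμa : IsAlgebraic ℚ μ) (hνa : IsAlgebraic ℚ ν)
    (hμ : μ ∈ Ioo (0:ℝ) 1) (hν : ν ∈ Ioo (0:ℝ) 1) :
    mkQ (of (sliceRep μ hμa hμ)) = mkQ (of (sliceRep ν hνa hν)) :=
  mkQ_eq_mkQ_iff.mpr (sliceRep_equivalent hμa hνa hμ hν)

/-- At `μ = 1/2` the Legendre form splits into lemniscatic normal forms: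
`F(x,y,½) = g_B(x) g_K(y) + g_K(x) g_B(y)`. -/
theorem legF_half {x y : ℝ} (hx : x ∈ Ioo (0:ℝ) 1) (hy : y ∈ Ioo (0:ℝ) 1) :
    legF x y (1 / 2) = legB x * legK y + legK x * legB y := by
  obtain ⟨hPx, h2x, -⟩ := sqrtChart_aux hx
  obtain ⟨hPy, h2y, -⟩ := sqrtChart_aux hy
  have hB : ∀ {s : ℝ}, 0 < 1 - s ^ 2 →
      legB s = Real.sqrt (1 - s ^ 2) / Real.sqrt (2 - s ^ 2) := fun hs => by
    rw [legB, Real.sqrt_div hs.le]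
  have hK : ∀ {s : ℝ}, 0 < 1 - s ^ 2 →
      legK s = 1 / (Real.sqrt (1 - s ^ 2) * Real.sqrt (2 - s ^ 2)) := fun hs => by
    rw [legK, Real.sqrt_mul hs.le]
  have hT : legT x y (1 / 2) = Real.sqrt (1 - x ^ 2) * Real.sqrt (2 - x ^ 2) *
      (Real.sqrt (1 - y ^ 2) * Real.sqrt (2 - y ^ 2)) / 2 := by
    rw [legT, show legU x y (1 / 2) = (Real.sqrt (1 - x ^ 2) * Real.sqrt (2 - x ^ 2) *
      (Real.sqrt (1 - y ^ 2) * Real.sqrt (2 - y ^ 2)) / 2) ^ 2 by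
        rw [div_pow, mul_pow, mul_pow, mul_pow, Real.sq_sqrt hPx.le, Real.sq_sqrt h2x.le,
          Real.sq_sqrt hPy.le, Real.sq_sqrt h2y.le, legU]; ring,
      Real.sqrt_sq (by positivity)]
  rw [legF, hT, hB hPx, hB hPy, hK hPx, hK hPy]
  set p := Real.sqrt (1 - x ^ 2) with hp
  set q := Real.sqrt (2 - x ^ 2)
  set r := Real.sqrt (1 - y ^ 2) with hr
  set w := Real.sqrt (2 - y ^ 2)
  have hp2 : 1 - x ^ 2 = p ^ 2 := (Real.sq_sqrt hPx.le).symm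
  have hr2 : 1 - y ^ 2 = r ^ 2 := (Real.sq_sqrt hPy.le).symm
  have hp0 : 0 < p := Real.sqrt_pos.mpr hPx
  have hq0 : 0 < q := Real.sqrt_pos.mpr h2x
  have hr0 : 0 < r := Real.sqrt_pos.mpr hPy
  have hw0 : 0 < w := Real.sqrt_pos.mpr h2y
  rw [hp2, hr2]
  field_simp
  ring
/-- **The anchor move** (rule (1)): `L_½ - [g_B][g_K] - [g_K][g_B]` is a relation. -/
theorem sliceRep_half_sub (ha : IsAlgebraic ℚ (1 / 2 : ℝ)) (hm : (1 / 2 : ℝ) ∈ Ioo (0:ℝ) 1) :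
    of (sliceRep (1 / 2) ha hm) - of (legB1.prod legK1) - of (legK1.prod legB1) ∈ relations := by
  refine integrandAddRel_subset_relations ⟨2, sliceRep (1 / 2) ha hm, legB1.prod legK1,
    legK1.prod legB1, prod_domain_eq_usq _ _ rfl rfl, prod_domain_eq_usq _ _ rfl rfl,
    fun w hw => ?_, rfl⟩
  rw [Pi.add_apply, IntegralRep.prod_integrand_eq, IntegralRep.prodFun_apply,
    IntegralRep.prod_integrand_eq, IntegralRep.prodFun_apply]
  simp only [sliceRep_integrand, legB1, legK1, lineRep_integrand,
    (show (Fin.castAdd 1 (0 : Fin 1) : Fin 2) = 0 from rfl),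
    (show (Fin.natAdd 1 (0 : Fin 1) : Fin 2) = 1 from rfl)]
  exact legF_half hw.1 hw.2

/-- **`[L_½] = 2·a(1)`** by the anchor move, Fubini and Euler's identity `[g_K][g_B] = a(1)`. -/
theorem mkQ_sliceRep_half (ha : IsAlgebraic ℚ (1 / 2 : ℝ)) (hm : (1 / 2 : ℝ) ∈ Ioo (0:ℝ) 1) :
    mkQ (of (sliceRep (1 / 2) ha hm)) = (2 : K₀) • alpha 1 := by
  have h : mkQ (of (sliceRep (1 / 2) ha hm)) =
      mkQ (of (legB1.prod legK1)) + mkQ (of (legK1.prod legB1)) := by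
    rw [← map_add, mkQ_eq_mkQ_iff, ← sub_sub]
    exact sliceRep_half_sub ha hm
  rw [h, ← of_mul_of, ← of_mul_of, mkQ_mul, mkQ_mul, mul_comm (mkQ (of legB1)), legendre_euler,
    ofNat_smul_eq_nsmul, two_nsmul]

/-- The angle cell `[[0,1], 2/(1+t²)]` is `ℚ`-rational. -/
theorem isRational_angleCell : angleCell.IsRational := by
  have e : angleCell = atanCell ((2 : ℚ) : ℝ) 1 (isAlgebraic_rat ℚ 2) isAlgebraic_one := by
    unfold angleCell
    congr 1
  rw [e]
  exact isRational_atanCell 2 isAlgebraic_one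

section

variable {μ : ℝ} (hμa : IsAlgebraic ℚ μ) (hμ : μ ∈ Ioo (0:ℝ) 1)
include hμa hμ

/-- **`[L_μ] = 2·a(1)` in `Q`** for every real algebraic `μ ∈ (0,1)`. -/
theorem mkQ_sliceRep : mkQ (of (sliceRep μ hμa hμ)) = (2 : K₀) • alpha 1 := by
  have ha' : IsAlgebraic ℚ (((1 / 2 : ℚ)) : ℝ) := isAlgebraic_rat ℚ _
  have ha : IsAlgebraic ℚ (1 / 2 : ℝ) := by simpa using ha'
  have hm : (1 / 2 : ℝ) ∈ Ioo (0:ℝ) 1 := ⟨by norm_num, by norm_num⟩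
  rw [mkQ_sliceRep_eq hμa ha hμ hm, mkQ_sliceRep_half ha hm]

/-- **Legendre's relation inside the rules.** `L_μ = [(0,1)², F(·,·,μ)]` (value
`E K' + E' K - K K'` at `k² = μ`) is KZ-equivalent to the angle cell `[[0,1], 2/(1+t²)]`
(value `π/2`), for every real algebraic `μ ∈ (0,1)`. -/
theorem kz_legendre : Equivalent (sliceRep μ hμa hμ) angleCell := by
  rw [Equivalent, ← mkQ_eq_mkQ_iff, mkQ_sliceRep hμa hμ, mkQ_angleCell]

/-- **Legendre's relation** as an identity of real numbers:
`∫∫_{(0,1)²} (μ(1-x²) + (1-μ)(1-y²))/√((1-x²)(1-μx²)(1-y²)(1-(1-μ)y²)) dx dy = π/2`. -/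
theorem sliceRep_value : (sliceRep μ hμa hμ).value = Real.pi / 2 := by
  have h := congrArg evalQ (mkQ_sliceRep hμa hμ)
  rw [evalQ_mkQ, eval_of, evalQ_smul, evalQ_alpha isAlgebraic_one zero_le_one,
    Real.arctan_one] at h
  rw [h, show ((2 : K₀) : ℝ) = 2 by norm_cast]
  ring

/-- **The conjecture for Legendre's relation.** The volume-under-the-graph representation of
`L_μ` (dimension `3`, `ℚ`-rational) and the angle cell (dimension `1`, `ℚ`-rational) — two
rational representations of the period `π/2` in the literal sense of the Statement — are
KZ-equivalent. -/
theorem kz_legendre_graph :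
    ((sliceRep μ hμa hμ).graphRep
        Literature.ModelTheory.ExponentialFields.tarski_seidenberg_real_holds).IsRational ∧
      angleCell.IsRational ∧
      Equivalent ((sliceRep μ hμa hμ).graphRep
        Literature.ModelTheory.ExponentialFields.tarski_seidenberg_real_holds) angleCell :=
  ⟨IntegralRep.isRational_graphRep _ _, isRational_angleCell,
    ((sliceRep μ hμa hμ).equivalent_graphRep _).symm.trans (kz_legendre hμa hμ)⟩

end

end Deformation

section ProductForm

/-- **`F(x,y,μ) + f_μ(x) f_ν(y) = e_μ(x) f_ν(y) + f_μ(x) e_ν(y)`** on `(0,1)²` (`μ + ν = 1`). -/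
theorem legF_add_split {x y μ ν : ℝ} (hx : x ∈ Ioo (0:ℝ) 1) (hy : y ∈ Ioo (0:ℝ) 1)
    (hμ : μ ∈ Ioo (0:ℝ) 1) (hμν : μ + ν = 1) :
    legF x y μ + ellKf μ x * ellKf ν y = ellEf μ x * ellKf ν y + ellKf μ x * ellEf ν y := by
  obtain rfl : ν = 1 - μ := by linarith
  have hμ' : μ ∈ Icc (0:ℝ) 1 := Ioo_subset_Icc_self hμ
  have hν' : 1 - μ ∈ Icc (0:ℝ) 1 := ⟨by linarith [hμ.2], by linarith [hμ.1]⟩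
  obtain ⟨h1, h2, -⟩ := ell_aux hx hμ'
  obtain ⟨h3, h4, -⟩ := ell_aux hy hν'
  rw [ellEf_eq hx hμ', ellEf_eq hy hν', legF,
    legT_eq_prod (by nlinarith [hx.1, hx.2]) (by nlinarith [hy.1, hy.2]) hμ', ellKf, ellKf,
    Real.sqrt_mul h1.le, Real.sqrt_mul h3.le]
  have := Real.sqrt_pos.mpr h1
  have := Real.sqrt_pos.mpr h2
  have := Real.sqrt_pos.mpr h3
  have := Real.sqrt_pos.mpr h4
  field_simp
  ring

section main
variable {μ ν : ℝ} (hμa : IsAlgebraic ℚ μ) (hνa : IsAlgebraic ℚ ν) (hμ : μ ∈ Ioo (0:ℝ) 1)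
  (hν : ν ∈ Ioo (0:ℝ) 1)

/-- The auxiliary representation `[(0,1)², e_μ(x) f_ν(y) + f_μ(x) e_ν(y)]`. -/
def splitRep : IntegralRep 2 where
  domain := usq
  integrand w := ellEf μ (w 0) * ellKf ν (w 1) + ellKf μ (w 0) * ellEf ν (w 1)
  isSemialgebraic_domain := isSemialgebraic_usq
  isSemialgebraicFunOn_integrand :=
    ((isSemialgebraicFunOn_ellEf (isSemialgebraicFunOn_apply isSemialgebraic_usq 0) hμa).fun_mul
      (isSemialgebraicFunOn_ellKf (isSemialgebraicFunOn_apply isSemialgebraic_usq 1)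
        hνa)).fun_add
    ((isSemialgebraicFunOn_ellKf (isSemialgebraicFunOn_apply isSemialgebraic_usq 0) hμa).fun_mul
      (isSemialgebraicFunOn_ellEf (isSemialgebraicFunOn_apply isSemialgebraic_usq 1)
        hνa))
  integrableOn := by
    have hμ' : μ ∈ Ico (0:ℝ) 1 := Ioo_subset_Ico_self hμ
    have hν' : ν ∈ Ico (0:ℝ) 1 := Ioo_subset_Ico_self hν
    refine integrableOn_usq_of_le (by unfold ellEf ellKf; fun_prop)
      (1 / Real.sqrt (1 - μ) * (1 / Real.sqrt (1 - ν)) +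
        1 / Real.sqrt (1 - μ) * (1 / Real.sqrt (1 - ν))) fun w hw => ?_
    have hA := abs_ellEf_le hw.1 hμ'
    have hB := abs_ellKf_le hw.2 hν'
    have hC := abs_ellKf_le hw.1 hμ'
    have hD := abs_ellEf_le hw.2 hν'
    have h0 : 0 ≤ 1 / Real.sqrt (1 - w 0) := by positivity
    have h1 : 0 ≤ 1 / Real.sqrt (1 - w 1) := by positivity
    have hm : 0 ≤ 1 / Real.sqrt (1 - μ) := by positivity
    have hn : 0 ≤ 1 / Real.sqrt (1 - ν) := by positivity
    calc |ellEf μ (w 0) * ellKf ν (w 1) + ellKf μ (w 0) * ellEf ν (w 1)|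
        ≤ |ellEf μ (w 0)| * |ellKf ν (w 1)| + |ellKf μ (w 0)| * |ellEf ν (w 1)| := by
          rw [← abs_mul, ← abs_mul]; exact abs_add_le _ _
      _ ≤ 1 / Real.sqrt (1 - μ) * (1 / Real.sqrt (1 - w 0)) *
            (1 / Real.sqrt (1 - ν) * (1 / Real.sqrt (1 - w 1))) +
          1 / Real.sqrt (1 - μ) * (1 / Real.sqrt (1 - w 0)) *
            (1 / Real.sqrt (1 - ν) * (1 / Real.sqrt (1 - w 1))) := by
          exact add_le_add (mul_le_mul hA hB (abs_nonneg _) (by positivity))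
            (mul_le_mul hC hD (abs_nonneg _) (by positivity))
      _ = _ := by ring

/-- Move 1 (rule (1)): `[split] - L_μ - [K_μ × K_ν] ∈ relations` (`μ + ν = 1`). -/
theorem splitRep_sub_sliceRep_sub (hμν : μ + ν = 1) :
    of (splitRep hμa hνa hμ hν) - of (sliceRep μ hμa hμ) -
      of ((ellK μ hμa hμ).prod (ellK ν hνa hν)) ∈
      relations := by
  refine integrandAddRel_subset_relations ⟨2, splitRep hμa hνa hμ hν, sliceRep μ hμa hμ,
    (ellK μ hμa hμ).prod (ellK ν hνa hν), rfl,
    prod_domain_eq_usq _ _ rfl rfl, fun w hw => ?_, rfl⟩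
  rw [Pi.add_apply, IntegralRep.prod_integrand_eq, IntegralRep.prodFun_apply]
  simp only [sliceRep_integrand, ellK_integrand,
    (show (Fin.castAdd 1 (0 : Fin 1) : Fin 2) = 0 from rfl),
    (show (Fin.natAdd 1 (0 : Fin 1) : Fin 2) = 1 from rfl)]
  exact (legF_add_split hw.1 hw.2 hμ hμν).symm

/-- Move 2 (rule (1)): `[split] - [E_μ × K_ν] - [K_μ × E_ν] ∈ relations`. -/
theorem splitRep_sub_prod_sub :
    of (splitRep hμa hνa hμ hν) -
      of ((ellE μ hμa hμ).prod (ellK ν hνa hν)) -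
      of ((ellK μ hμa hμ).prod (ellE ν hνa hν)) ∈
      relations := by
  refine integrandAddRel_subset_relations ⟨2, splitRep hμa hνa hμ hν,
    (ellE μ hμa hμ).prod (ellK ν hνa hν),
    (ellK μ hμa hμ).prod (ellE ν hνa hν),
    prod_domain_eq_usq _ _ rfl rfl, prod_domain_eq_usq _ _ rfl rfl, fun w hw => ?_, rfl⟩
  rw [Pi.add_apply, IntegralRep.prod_integrand_eq, IntegralRep.prodFun_apply,
    IntegralRep.prod_integrand_eq, IntegralRep.prodFun_apply]
  simp only [ellK_integrand, ellE_integrand,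
    (show (Fin.castAdd 1 (0 : Fin 1) : Fin 2) = 0 from rfl),
    (show (Fin.natAdd 1 (0 : Fin 1) : Fin 2) = 1 from rfl)]
  rfl

/-- **Legendre's relation in `Q`.** `[E_μ][K_ν] + [K_μ][E_ν] - [K_μ][K_ν] = 2·a(1)`. -/
theorem mkQ_legendre (hμν : μ + ν = 1) :
    mkQ (of (ellE μ hμa hμ)) * mkQ (of (ellK ν hνa hν)) +
      mkQ (of (ellK μ hμa hμ)) * mkQ (of (ellE ν hνa hν)) -
      mkQ (of (ellK μ hμa hμ)) * mkQ (of (ellK ν hνa hν)) = (2 : K₀) • alpha 1 := by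
  have h1 := mkQ_eq_mkQ_iff.mpr
    (show of (splitRep hμa hνa hμ hν) - (of (sliceRep μ hμa hμ) + of ((ellK μ hμa hμ).prod
      (ellK ν hνa hν))) ∈ relations by
      rw [← sub_sub]; exact splitRep_sub_sliceRep_sub hμa hνa hμ hν hμν)
  have h2 := mkQ_eq_mkQ_iff.mpr
    (show of (splitRep hμa hνa hμ hν) - (of ((ellE μ hμa hμ).prod
      (ellK ν hνa hν)) + of ((ellK μ hμa hμ).prod
      (ellE ν hνa hν))) ∈ relations by
      rw [← sub_sub]; exact splitRep_sub_prod_sub hμa hνa hμ hν)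
  rw [map_add, ← of_mul_of, mkQ_mul, mkQ_sliceRep hμa hμ] at h1
  rw [map_add, ← of_mul_of, ← of_mul_of, mkQ_mul, mkQ_mul] at h2
  rw [← h2, h1]
  abel

/-- **Legendre's relation inside the rules.**
`[E_μ × K_ν] + [K_μ × E_ν] - [K_μ × K_ν] - [[0,1], 2/(1+t²)] ∈ relations` for every real
algebraic `μ, ν ∈ (0,1)` with `μ + ν = 1`: the `ℤ`-linear relation `E K' + K E' - K K' - π/2 = 0`
among these four periods is generated by the three rules. -/
theorem legendre_mem_relations (hμν : μ + ν = 1) :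
    of ((ellE μ hμa hμ).prod (ellK ν hνa hν)) +
      of ((ellK μ hμa hμ).prod (ellE ν hνa hν)) -
      of ((ellK μ hμa hμ).prod (ellK ν hνa hν)) -
      of angleCell ∈ relations := by
  rw [← mkQ_eq_mkQ_iff, map_sub, map_add, ← of_mul_of, ← of_mul_of, ← of_mul_of, mkQ_mul,
    mkQ_mul, mkQ_mul, mkQ_legendre hμa hνa hμ hν hμν, mkQ_angleCell]

/-- **Legendre's relation** `E(k) K(k') + K(k) E(k') - K(k) K(k') = π/2` (`k² = μ`, `k'² = ν`
real algebraic in `(0,1)`, `μ + ν = 1`), as an identity between the values. -/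
theorem legendre_relation (hμν : μ + ν = 1) :
    (ellE μ hμa hμ).value * (ellK ν hνa hν).value +
      (ellK μ hμa hμ).value * (ellE ν hνa hν).value -
      (ellK μ hμa hμ).value * (ellK ν hνa hν).value = Real.pi / 2 := by
  have h := congrArg evalQ (mkQ_legendre hμa hνa hμ hν hμν)
  simp only [map_sub, map_add, map_mul, evalQ_mkQ, eval_of] at h
  rw [h, evalQ_smul, evalQ_alpha isAlgebraic_one zero_le_one, Real.arctan_one,
    show ((2 : K₀) : ℝ) = 2 by norm_cast]
  ring

/-- **Legendre's relation**, unfolded to the four integrals over `(0,1)`. -/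
theorem legendre_relation_integral (hμa : IsAlgebraic ℚ μ) (hνa : IsAlgebraic ℚ ν)
    (hμ : μ ∈ Ioo (0:ℝ) 1) (hν : ν ∈ Ioo (0:ℝ) 1) (hμν : μ + ν = 1) :
    (∫ x in Ioo (0:ℝ) 1, ellEf μ x) * (∫ x in Ioo (0:ℝ) 1, ellKf ν x) +
      (∫ x in Ioo (0:ℝ) 1, ellKf μ x) * (∫ x in Ioo (0:ℝ) 1, ellEf ν x) -
      (∫ x in Ioo (0:ℝ) 1, ellKf μ x) * (∫ x in Ioo (0:ℝ) 1, ellKf ν x) = Real.pi / 2 := by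
  have h := legendre_relation hμa hνa hμ hν hμν
  simpa only [ellK_value, ellE_value] using h

end main

end ProductForm

end SoloBlind

end Summit.KontsevichZagierPeriods.KontsevichZagierPeriods.Theorems
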